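import Literature.MathematicalPhysics.QuantumFieldTheory.Balaban1983to89.B8Eq131DerivationRec
import Literature.MathematicalPhysics.QuantumFieldTheory.Balaban1983to89.B7Eq123GeneralRec
import Literature.MathematicalPhysics.QuantumFieldTheory.Balaban1983to89.B8Eq137QjEqB

/-!
# `Balaban1983to89.B8Eq137QjEqBRec` — RECORD TWIN of `B8Eq137QjEqB` §1–§5 ([Balaban1985RegularSpaces] Theorem 2, the FIRST HALF of the line (1.37) p. 82:
# «Q_j(U₀, ηA) = B on Λ_j, … B is given by formula (1.31) with V′ = Ũ′ʲ», and the (1.42) clause «|Q_j(U₀, ηA)| < 2dLα₁» from (1.35)) FOR THE SYMMETRISED CENTRED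
# block averaging (0.4) of [Balaban1987RG1] — with the RECORD's Prop-4 regime (director-ym №267: «(128)∕(130)∕(131) hold for the record k-uniformly with constants ×(1+4dL)»)

statement-level skeleton of published theorems with citation tags; proofs where landed; nothing here is a claim about the Yang–Mills mass gap

T. Bałaban, *Spaces of regular gauge field configurations on a lattice and gauge fixing conditions*, Commun. Math. Phys. **99** (1985) 75–102 `[Balaban1985RegularSpaces]`
("[6]"): (1.37) p. 82, (1.31) p. 82, (1.42) p. 83, (1.35) p. 82, p. 83 («basically of an algebraic character»); T. Bałaban, *Averaging operations for lattice gauge theories*,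
Commun. Math. Phys. **98** (1985) 17–51 `[Balaban1985Averaging]` ("[3]"): (127) p. 37, p. 38, (121) p. 36, (90)–(92) p. 31, Prop. 4 p. 38; T. Bałaban, *Renormalization group
approach to lattice gauge field theories. I*, Commun. Math. Phys. **109** (1987) 249–301 `[Balaban1987RG1]` ("[I]"): (0.3)–(0.4) pp. 252–253.  STATUS: published, refereed.

CITATION HEADER (lean-in-tree rule).  Cell `pub-ymgap`, «N05-REC» stage 2 (director-ym №254∕№255∕№265∕№267), item R5 sub-chain β, head 2 — typed by the LEAD PEN dag-n05-e
g38 on dag-n05-c's recipe (`pub-ymgap-dag-n05-c/HANDOFF.md` g26 «NEXT: β `B8Eq137QjEqBRec`»; inventory `N05-REC-INVENTORY.md` e50db04501ab292d §R5 row `B8Eq137QjEqB`: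
class A = `logCovIter_succ_eq_mlog logCovIter_zero_eq_mlog Qj_eq_Bint Qj_eq_Bint_zero Qj_eq_Bcross Qj_eq_BcrossMirror norm_Qj_lt_interior norm_Qj_lt_interior_zero
norm_Qj_lt_crossing norm_Qj_lt_crossing_mirrored Qj_eq_Bint_regular norm_Qj_lt_interior_regular norm_Qj_lt_crossing_regular`).  WHAT IS REPRODUCED = ✓`B8Eq137QjEqB` §1–§5
over dag-n05-d's `B8Eq131DerivationRec` (p. 81–82 on the certified RECORD averages: `eq130_interior`, `eq131_crossing`, `eq131_crossing_mirrored`, `eq137_interior`,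
`eq137_crossing`, `pert_avgIterZ_eq_tildIterZ`), `B8Thm2LogBRec` (`BcrossZ`, `BcrossMirrorZ`, `ineq137_crossing_mirrored`) and dag-n05-e's `B7Eq123GeneralRec`
(`dbavgCovIterZ_eq_expCfg_logCovIterZ`, `level_dataZ` — [3] (127) for the record, k-uniform): TOKEN MAP `dbavgCovIter ∕ logCovIter ∕ Qcov ∕ tildIter ∕ wrec ∕ avgIter ∕ Bcross L ∕
BcrossMirror L ↦ dbavgCovIterZ ∕ logCovIterZ ∕ QcovZ L ∕ tildIterZ ∕ wrecZ ∕ avgIterZ ∕ BcrossZ L ∕ BcrossMirrorZ L`, the corner block box `[L•y, L•y + blockTop L]` ↦ the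
CENTRED box `[L•y − halfVec L, L•y + halfVec L]` ([I] (0.3)), and in §5 the engine's Prop-4 regime ↦ the RECORD's (`B7Eq123GeneralRec.prop4_generalZ`): odd `L = 2s+1` with
`1 ≤ s`, `1 ≤ d`, `AvgClosed ↦ AvgClosedZ`, `C0 ↦ C0Z`, `e^{4·800(d+1)²(d+4)·α₀}(1 + 8C₁Lᵏb) ≤ 2 ↦ e^{4·cZ(d)·α₀}(1 + 2C₁·KZ(d,L)²·Lᵏb) ≤ 2`, `2·Lᵏb ≤ c₃ ↦ KZ(d,L)·Lᵏb ≤ c₃`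
(`C₁ = 131072(d+1)²`; `cZ ∕ gZ ∕ KZ` of `B7Prop4GeneralLevelsRec`).  Declaration names = engine names (T5); proofs = the engine's lines over the record inputs.  The engine's
§6–§8 (B8 currency `B₀ = iηA`, the (87)-hypotheses in the typed classes) are structure-free corollaries NOT on the record crown's path (class B∕C in the inventory); not
twinned here.  Kind «kernel-checked proof», theorems only; no `def`, no `instance`, no `notation`, no existing module modified.  `--supports stmt-QuantumFields-20541`
(K0⁷-keyed, COUNT-NEUTRAL).

HONEST SCOPE: the (1.37) line of Theorem 2 and the (1.42) clause, for the record's centred averaging, by NAME over the landed record Sect. C derivation and the record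
Prop 4; nothing of Bałaban's analysis re-proved here; `HThm4Rec` UNDISCHARGED; caveat (C-S3-1) + addendum v4 («hybrid record — (128)∕(130)∕(131) hold for the record
k-uniformly with constants ×(1+4dL); the carried coarse gauge letter Λ_j is absorbed into the data B₁ of (1.56) by the Stokes estimate; flat-letter layer off the path modulo
N2a–c»); N05 [B8] DISCHARGED OF RECORD untouched; COUNT of record unmoved · K numerically unchanged; one finite `𝕋⁴` programme at fixed `ε`, Bałaban AS PRINTED; nothing
continuum ∕ ℝ⁴ ∕ OS ∕ mass-gap ∕ Clay.  No `sorry`, no `def`.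

[cite: Balaban1985RegularSpaces, (1.37) p.82, (1.31) p.82, (1.42) p.83, (1.35) p.82; Balaban1985Averaging, (127) p.37, p.38, (121) p.36, (90)–(92) p.31; Balaban1987RG1, (0.3)–(0.4) pp.252–253]
-/

noncomputable section

open NormedSpace Finset Complex

namespace Literature.MathematicalPhysics.QuantumFieldTheory.Balaban1983to89.B8Eq137QjEqBRec

open B7Prop1Explicit B7Prop2Explicit MatrixLog B7AvgGaugeCovariance
open B7Eq92Concrete (mgauge mgauge_apply)
open B7Prop3Flat (expCfg c3 c3_pos)
open B7Prop2Rec (AvgClosedZ C0Z)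
open B7Prop4GeneralLevelsRec (cZ gZ KZ gZ_nonneg)
open BlockAveragingZd (avgIterZ)
open B7SectCDGaugeAveragesRec (tildIterZ dbavgCovIterZ wrecZ tildIterZ_apply dbavgCovIterZ_zero dbavgCovIterZ_succ)
open B7SectEFLinearisationRec (QcovZ logCovIterZ linCovIterZ logCovIterZ_zero logCovIterZ_succ)
open B7Eq123GeneralRec (dbavgCovIterZ_eq_expCfg_logCovIterZ level_dataZ)
open B7BlockAvgLog (mlog_exp)
open B7Prop1Local (InBox)
open B8Lemma1NonAbelian (pert)
open B8Lemma1NonAbelianRecLoops (halfVec)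
open B8Thm2LogB (Bint)
open B8Thm2LogBRec (BcrossZ BcrossMirrorZ)
open B8Eq131DerivationRec (eq130_interior eq131_crossing eq131_crossing_mirrored eq137_interior eq137_crossing pert_avgIterZ_eq_tildIterZ)
open B8Eq137QjEqB (lt_log_two_of_regime)

-- `Site` alone would resolve to the torus sites of `Setup.lean`; re-export the `ℤ^d` sites of `B7Prop1Explicit`.
export B7Prop1Explicit (Site)

variable {d : ℕ}
variable {𝔸 : Type*} [NormedRing 𝔸] [NormOneClass 𝔸] [NormedAlgebra ℂ 𝔸] [CompleteSpace 𝔸]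

/-! ## §1 [3] (127) read backwards, record structure: `Q_{j+1}(U₀, ηA) = log U̿₁^{j+1}` once `U̿₁ʲ = exp Q_j(U₀, ηA)` -/

omit [NormOneClass 𝔸] in
/-- (RECORD TWIN of `B8Eq137QjEqB.logCovIter_succ_eq_mlog`.) **[3] (127)∕(121) vs (91), bondwise, centred averages**: if the level-`j` identification
`U̿₁ʲ = e^{Q_j(U₀, ηA)}` holds (`hId`; unconditional in the record's Prop-4 regime: `B7Eq123GeneralRec.dbavgCovIterZ_eq_expCfg_logCovIterZ`), then at EVERY bond of the
`(j+1)`-lattice `Q_{j+1}(U₀, ηA)_b = log (U̿₁^{j+1})_b`. No smallness. [cite: Balaban1985Averaging, (127) p.37, (121) p.36, (91) p.31; Balaban1987RG1, (0.4) p.253] -/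
theorem logCovIter_succ_eq_mlog (L : ℕ) (U₀ : Site d → Fin d → 𝔸ˣ) (B₀ : Site d → Fin d → 𝔸) (j : ℕ)
    (hId : dbavgCovIterZ L U₀ (expCfg B₀) j = expCfg (logCovIterZ L U₀ B₀ j)) (z : Site d) (κ : Fin d) :
    logCovIterZ L U₀ B₀ (j + 1) z κ = mlog ((dbavgCovIterZ L U₀ (expCfg B₀) (j + 1) z κ : 𝔸ˣ) : 𝔸) := by
  rw [logCovIterZ_succ, QcovZ, dbavgCovIterZ_succ, rescale_apply, hId]

omit [NormOneClass 𝔸] in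
/-- (RECORD TWIN of `B8Eq137QjEqB.logCovIter_zero_eq_mlog`.) Level `0`: `Q₀(U₀, ηA)_b = ηA_b = (1∕i) log U₁(b)` for `U₁ = e^{iηA}` with `|ηA_b| < ln 2`.
[cite: Balaban1985RegularSpaces, p.83 («the representation of U₁»); Balaban1985Averaging, (127) p.37, (90) p.31] -/
theorem logCovIter_zero_eq_mlog (L : ℕ) (U₀ : Site d → Fin d → 𝔸ˣ) (B₀ : Site d → Fin d → 𝔸) (z : Site d)
    (κ : Fin d) (h0 : ‖B₀ z κ‖ < Real.log 2) :
    logCovIterZ L U₀ B₀ 0 z κ = mlog ((dbavgCovIterZ L U₀ (expCfg B₀) 0 z κ : 𝔸ˣ) : 𝔸) := by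
  simp only [logCovIterZ_zero, dbavgCovIterZ_zero, expCfg, val_expUnit]
  rw [mlog_exp h0]

/-! ## §2 (1.37), first half, on an interior bond `b ⊂ Λ_{j+1}`, record structure -/

omit [NormOneClass 𝔸] in
/-- (RECORD TWIN of `B8Eq137QjEqB.Qj_eq_Bint`.) **(1.37) «Q_j(U₀, ηA) = B on Λ_j, B is given by formula (1.31) with V′ = Ũ′ʲ», INTERIOR bond**, centred averages (stated at
the level `j + 1`): for `U₁ = e^{B₀}`, (87) at `b₋`, `b₊` and `hId`, `Q_{j+1}(U₀, ηA)_b = i·B_b` EXACTLY, `B_b = (1∕i) log Ũ′^{j+1}_b` — dag-n05-d's `eq130_interior` and §1.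
[cite: Balaban1985RegularSpaces, (1.37) p.82, (1.31) p.82, p.83; Balaban1985Averaging, (127) p.37, (92) p.31; Balaban1987RG1, (0.4) p.253] -/
theorem Qj_eq_Bint (L : ℕ) (U₀ : Site d → Fin d → 𝔸ˣ) (B₀ : Site d → Fin d → 𝔸) (u : Site d → 𝔸ˣ) (j : ℕ)
    (hId : dbavgCovIterZ L U₀ (expCfg B₀) j = expCfg (logCovIterZ L U₀ B₀ j)) (y : Site d) (κ : Fin d)
    (hm : uLev L u (j + 1) y = (wrecZ L U₀ (expCfg B₀) (j + 1) y)⁻¹)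
    (hp : uLev L u (j + 1) (y + e κ) = (wrecZ L U₀ (expCfg B₀) (j + 1) (y + e κ))⁻¹) :
    logCovIterZ L U₀ B₀ (j + 1) y κ = I • Bint (tildIterZ L U₀ (mgauge U₀ u (expCfg B₀)) (j + 1) y κ) := by
  rw [logCovIter_succ_eq_mlog L U₀ B₀ j hId, ← eq130_interior L U₀ (expCfg B₀) u (j + 1) y κ hm hp, Bint, smul_smul,
    mul_inv_cancel₀ I_ne_zero, one_smul]

omit [NormOneClass 𝔸] in
/-- (RECORD TWIN of `B8Eq137QjEqB.Qj_eq_Bint_zero`.) **(1.37), interior bond, level `0`**: `Q₀(U₀, ηA)_b = i·B_b`, `B_b = (1∕i) log U′_b`, from (87) at level `0` at `b₋`,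
`b₊` and `|ηA_b| < ln 2`. [cite: Balaban1985RegularSpaces, (1.37) p.82, (1.14) p.78, p.83] -/
theorem Qj_eq_Bint_zero (L : ℕ) (U₀ : Site d → Fin d → 𝔸ˣ) (B₀ : Site d → Fin d → 𝔸) (u : Site d → 𝔸ˣ)
    (y : Site d) (κ : Fin d) (h0 : ‖B₀ y κ‖ < Real.log 2)
    (hm : uLev L u 0 y = (wrecZ L U₀ (expCfg B₀) 0 y)⁻¹)
    (hp : uLev L u 0 (y + e κ) = (wrecZ L U₀ (expCfg B₀) 0 (y + e κ))⁻¹) :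
    logCovIterZ L U₀ B₀ 0 y κ = I • Bint (tildIterZ L U₀ (mgauge U₀ u (expCfg B₀)) 0 y κ) := by
  rw [logCovIter_zero_eq_mlog L U₀ B₀ y κ h0, ← eq130_interior L U₀ (expCfg B₀) u 0 y κ hm hp, Bint, smul_smul,
    mul_inv_cancel₀ I_ne_zero, one_smul]

/-! ## §3 (1.37), first half, on the crossing bonds (stated one level up), CENTRED block boxes -/

omit [NormOneClass 𝔸] in
/-- (RECORD TWIN of `B8Eq137QjEqB.Qj_eq_Bcross`.) **(1.37), CROSSING bond** `b₋ ∈ Λ_j`, `b₊ ∈ Λ_{j+1}`, centred averages: for `U₁ = e^{B₀}`, (87) at the sites of the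
CENTRED block box `[L•y − s𝟙, L•y + s𝟙]` of `b₋` and at `b₊`, and `hId` at the level `j`: `Q_{j+1}(U₀, ηA)_b = i·B_b` EXACTLY with `B_b = B8Thm2LogBRec.BcrossZ L Ū₀ʲ Ũ′ʲ (L•y)
Ũ′^{j+1}_b` — dag-n05-d's `eq131_crossing` at `V := (U′U₀)‾` ((1.13) tautological) and §1 (odd `L`).
[cite: Balaban1985RegularSpaces, (1.37) p.82, (1.31) p.82; Balaban1985Averaging, (127) p.37, (92) p.31, (97) p.32, (99) p.32, (105) p.33; Balaban1987RG1, (0.3)–(0.4) pp.252–253] -/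
theorem Qj_eq_Bcross {L s : ℕ} (hLs : L = 2 * s + 1) (U₀ : Site d → Fin d → 𝔸ˣ) (B₀ : Site d → Fin d → 𝔸) (u : Site d → 𝔸ˣ)
    (j : ℕ) (hId : dbavgCovIterZ L U₀ (expCfg B₀) j = expCfg (logCovIterZ L U₀ B₀ j)) (y : Site d) (κ : Fin d)
    (h87 : ∀ x : Site d, InBox ((L : ℤ) • y - halfVec L) ((L : ℤ) • y + halfVec L) x →
      uLev L u j x = (wrecZ L U₀ (expCfg B₀) j x)⁻¹)
    (hp : uLev L u (j + 1) (y + e κ) = (wrecZ L U₀ (expCfg B₀) (j + 1) (y + e κ))⁻¹) :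
    logCovIterZ L U₀ B₀ (j + 1) y κ
      = I • BcrossZ L (avgIterZ L U₀ j) (tildIterZ L U₀ (mgauge U₀ u (expCfg B₀)) j) ((L : ℤ) • y)
          (tildIterZ L U₀ (mgauge U₀ u (expCfg B₀)) (j + 1) y κ) := by
  have hid := eq131_crossing hLs U₀ (expCfg B₀) u j y κ (avgIterZ L (mgauge U₀ u (expCfg B₀) * U₀) j)
    (avgIterZ L (mgauge U₀ u (expCfg B₀) * U₀) (j + 1)) h87 (fun _ _ _ _ => rfl) hp rfl
  rw [pert_avgIterZ_eq_tildIterZ] at hid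
  rw [tildIterZ_apply L U₀ _ (j + 1) y κ, logCovIter_succ_eq_mlog L U₀ B₀ j hId, hid, BcrossZ, smul_smul,
    mul_inv_cancel₀ I_ne_zero, one_smul]

omit [NormOneClass 𝔸] in
/-- (RECORD TWIN of `B8Eq137QjEqB.Qj_eq_BcrossMirror`.) **(1.37), MIRRORED crossing bond** `b₋ ∈ Λ_{j+1}`, `b₊ ∈ Λ_j`, centred averages: (87) at `b₋` (level `j + 1`)
and on the CENTRED block box of `b₊`, and `hId`: `Q_{j+1}(U₀, ηA)_b = i·B_b` EXACTLY with `B_b = B8Thm2LogBRec.BcrossMirrorZ …` — dag-n05-d's `eq131_crossing_mirrored` and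
§1 (odd `L`). [cite: Balaban1985RegularSpaces, (1.37) p.82, (1.31) p.82; Balaban1985Averaging, (127) p.37, (92) p.31; Balaban1987RG1, (0.3)–(0.4) pp.252–253] -/
theorem Qj_eq_BcrossMirror {L s : ℕ} (hLs : L = 2 * s + 1) (U₀ : Site d → Fin d → 𝔸ˣ) (B₀ : Site d → Fin d → 𝔸)
    (u : Site d → 𝔸ˣ) (j : ℕ) (hId : dbavgCovIterZ L U₀ (expCfg B₀) j = expCfg (logCovIterZ L U₀ B₀ j)) (y : Site d)
    (κ : Fin d) (hm : uLev L u (j + 1) y = (wrecZ L U₀ (expCfg B₀) (j + 1) y)⁻¹)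
    (h87 : ∀ x : Site d, InBox ((L : ℤ) • (y + e κ) - halfVec L) ((L : ℤ) • (y + e κ) + halfVec L) x →
      uLev L u j x = (wrecZ L U₀ (expCfg B₀) j x)⁻¹) :
    logCovIterZ L U₀ B₀ (j + 1) y κ
      = I • BcrossMirrorZ L (avgIterZ L U₀ j) (tildIterZ L U₀ (mgauge U₀ u (expCfg B₀)) j) ((L : ℤ) • (y + e κ))
          (avgIterZ L U₀ (j + 1) y κ) (tildIterZ L U₀ (mgauge U₀ u (expCfg B₀)) (j + 1) y κ) := by
  have hid := eq131_crossing_mirrored hLs U₀ (expCfg B₀) u j y κ (avgIterZ L (mgauge U₀ u (expCfg B₀) * U₀) j)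
    (avgIterZ L (mgauge U₀ u (expCfg B₀) * U₀) (j + 1)) hm h87 (fun _ _ _ _ => rfl) rfl
  rw [pert_avgIterZ_eq_tildIterZ] at hid
  rw [tildIterZ_apply L U₀ _ (j + 1) y κ, logCovIter_succ_eq_mlog L U₀ B₀ j hId, hid, BcrossMirrorZ, smul_smul,
    mul_inv_cancel₀ I_ne_zero, one_smul]

/-! ## §4 (1.37), second half, for `Q_j` = the (1.42) clause «|Q_j(U₀, ηA)| < 2dLα₁» from (1.35), record structure -/

/-- (RECORD TWIN of `B8Eq137QjEqB.norm_Qj_lt_interior`.) **«|B| < 2dLα₁ by the assumption (1.35)» for `Q_{j+1}(U₀, ηA)`, interior bond**, centred averages: under §2's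
hypotheses, `Ū₀^{j+1}_b ∈ U1` and (1.35) `|(U′U₀)‾^{j+1}_b − Ū₀^{j+1}_b| ≤ α₁` (`d, L ≥ 1`, `0 < α₁`, `dLα₁ ≤ 1∕8`): `‖Q_{j+1}(U₀, ηA)_b‖ < 2dLα₁` — dag-n05-d's
`eq137_interior` moved across `Qj_eq_Bint`. [cite: Balaban1985RegularSpaces, (1.37) p.82, (1.42) p.83, (1.35) p.82; Balaban1987RG1, (0.4) p.253] -/
theorem norm_Qj_lt_interior (L : ℕ) (hd : 1 ≤ d) (hL : 1 ≤ L) (U₀ : Site d → Fin d → 𝔸ˣ)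
    (B₀ : Site d → Fin d → 𝔸) (u : Site d → 𝔸ˣ) (j : ℕ)
    (hId : dbavgCovIterZ L U₀ (expCfg B₀) j = expCfg (logCovIterZ L U₀ B₀ j)) (y : Site d) (κ : Fin d)
    (hm : uLev L u (j + 1) y = (wrecZ L U₀ (expCfg B₀) (j + 1) y)⁻¹)
    (hp : uLev L u (j + 1) (y + e κ) = (wrecZ L U₀ (expCfg B₀) (j + 1) (y + e κ))⁻¹)
    (h₀ : avgIterZ L U₀ (j + 1) y κ ∈ U1 𝔸) {α₁ : ℝ} (hα : 0 < α₁) (hsmall : (d : ℝ) * L * α₁ ≤ 1 / 8)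
    (h135 : ‖(avgIterZ L (mgauge U₀ u (expCfg B₀) * U₀) (j + 1) y κ : 𝔸) - (avgIterZ L U₀ (j + 1) y κ : 𝔸)‖ ≤ α₁) :
    ‖logCovIterZ L U₀ B₀ (j + 1) y κ‖ < 2 * d * L * α₁ := by
  rw [Qj_eq_Bint L U₀ B₀ u j hId y κ hm hp, norm_smul, Complex.norm_I, one_mul]
  exact (eq137_interior L hd hL U₀ (expCfg B₀) u (j + 1) y κ hm hp h₀ hα hsmall h135).2

/-- (RECORD TWIN of `B8Eq137QjEqB.norm_Qj_lt_interior_zero`.) **Level `0`**: `‖Q₀(U₀, ηA)_b‖ = |ηA_b| < 2dLα₁` from (1.35) at the bond and `|ηA_b| < ln 2`.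
[cite: Balaban1985RegularSpaces, (1.37) p.82, (1.42) p.83, (1.35) p.82, (1.14) p.78] -/
theorem norm_Qj_lt_interior_zero (L : ℕ) (hd : 1 ≤ d) (hL : 1 ≤ L) (U₀ : Site d → Fin d → 𝔸ˣ)
    (B₀ : Site d → Fin d → 𝔸) (u : Site d → 𝔸ˣ) (y : Site d) (κ : Fin d) (h0 : ‖B₀ y κ‖ < Real.log 2)
    (hm : uLev L u 0 y = (wrecZ L U₀ (expCfg B₀) 0 y)⁻¹)
    (hp : uLev L u 0 (y + e κ) = (wrecZ L U₀ (expCfg B₀) 0 (y + e κ))⁻¹)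
    (h₀ : avgIterZ L U₀ 0 y κ ∈ U1 𝔸) {α₁ : ℝ} (hα : 0 < α₁) (hsmall : (d : ℝ) * L * α₁ ≤ 1 / 8)
    (h135 : ‖(avgIterZ L (mgauge U₀ u (expCfg B₀) * U₀) 0 y κ : 𝔸) - (avgIterZ L U₀ 0 y κ : 𝔸)‖ ≤ α₁) :
    ‖logCovIterZ L U₀ B₀ 0 y κ‖ < 2 * d * L * α₁ := by
  rw [Qj_eq_Bint_zero L U₀ B₀ u y κ h0 hm hp, norm_smul, Complex.norm_I, one_mul]
  exact (eq137_interior L hd hL U₀ (expCfg B₀) u 0 y κ hm hp h₀ hα hsmall h135).2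

/-- (RECORD TWIN of `B8Eq137QjEqB.norm_Qj_lt_crossing`.) **The same on a crossing bond** `b₋ ∈ Λ_j`, `b₊ ∈ Λ_{j+1}`, centred averages: under §3's hypotheses and the data
of dag-n05-d's `eq137_crossing` (`U1`-valued record averages, (1.35) on the bonds of the CENTRED block box of `b₋` and at `b`): `‖Q_{j+1}(U₀, ηA)_b‖ < 2dLα₁` (odd `L`).
[cite: Balaban1985RegularSpaces, (1.37) p.82, (1.42) p.83, (1.35) p.82; Balaban1987RG1, (0.3)–(0.4) pp.252–253] -/
theorem norm_Qj_lt_crossing {L s : ℕ} (hLs : L = 2 * s + 1) (hd : 1 ≤ d) (U₀ : Site d → Fin d → 𝔸ˣ)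
    (B₀ : Site d → Fin d → 𝔸) (u : Site d → 𝔸ˣ) (j : ℕ)
    (hId : dbavgCovIterZ L U₀ (expCfg B₀) j = expCfg (logCovIterZ L U₀ B₀ j)) (y : Site d) (κ : Fin d)
    (h87 : ∀ x : Site d, InBox ((L : ℤ) • y - halfVec L) ((L : ℤ) • y + halfVec L) x →
      uLev L u j x = (wrecZ L U₀ (expCfg B₀) j x)⁻¹)
    (hp : uLev L u (j + 1) (y + e κ) = (wrecZ L U₀ (expCfg B₀) (j + 1) (y + e κ))⁻¹)
    (hU : ∀ x μ, avgIterZ L (mgauge U₀ u (expCfg B₀) * U₀) j x μ ∈ U1 𝔸) (hV₀ : ∀ x μ, avgIterZ L U₀ j x μ ∈ U1 𝔸)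
    (hW : avgIterZ L (mgauge U₀ u (expCfg B₀) * U₀) (j + 1) y κ ∈ U1 𝔸) (hW₀ : avgIterZ L U₀ (j + 1) y κ ∈ U1 𝔸)
    {α₁ : ℝ} (hα : 0 < α₁) (hsmall : (d : ℝ) * L * α₁ ≤ 1 / 8)
    (h135 : ∀ (z : Site d) (μ : Fin d), (L : ℤ) • y - halfVec L ≤ z → z + e μ ≤ (L : ℤ) • y + halfVec L →
      ‖(avgIterZ L (mgauge U₀ u (expCfg B₀) * U₀) j z μ : 𝔸) - (avgIterZ L U₀ j z μ : 𝔸)‖ ≤ α₁)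
    (h135b : ‖(avgIterZ L (mgauge U₀ u (expCfg B₀) * U₀) (j + 1) y κ : 𝔸) - (avgIterZ L U₀ (j + 1) y κ : 𝔸)‖ ≤ α₁) :
    ‖logCovIterZ L U₀ B₀ (j + 1) y κ‖ < 2 * d * L * α₁ := by
  rw [Qj_eq_Bcross hLs U₀ B₀ u j hId y κ h87 hp, norm_smul, Complex.norm_I, one_mul]
  exact (eq137_crossing hLs hd U₀ (expCfg B₀) u j y κ h87 hp hU hV₀ hW hW₀ hα hsmall h135 h135b).2

/-- (RECORD TWIN of `B8Eq137QjEqB.norm_Qj_lt_crossing_mirrored`.) **The same on a mirrored crossing bond** `b₋ ∈ Λ_{j+1}`, `b₊ ∈ Λ_j`, centred averages: (87) at `b₋`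
and on the CENTRED block box of `b₊`, `U1`-valued record averages, (1.35) on the bonds of that box (level `j`) and at `b` (level `j + 1`): `‖Q_{j+1}(U₀, ηA)_b‖ < 2dLα₁`
(`B8Thm2LogBRec.ineq137_crossing_mirrored` moved across `Qj_eq_BcrossMirror`; odd `L`). [cite: Balaban1985RegularSpaces, (1.37) p.82, (1.42) p.83, (1.35) p.82; Balaban1987RG1, (0.3)–(0.4) pp.252–253] -/
theorem norm_Qj_lt_crossing_mirrored {L s : ℕ} (hLs : L = 2 * s + 1) (hd : 1 ≤ d) (U₀ : Site d → Fin d → 𝔸ˣ)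
    (B₀ : Site d → Fin d → 𝔸) (u : Site d → 𝔸ˣ) (j : ℕ)
    (hId : dbavgCovIterZ L U₀ (expCfg B₀) j = expCfg (logCovIterZ L U₀ B₀ j)) (y : Site d) (κ : Fin d)
    (hm : uLev L u (j + 1) y = (wrecZ L U₀ (expCfg B₀) (j + 1) y)⁻¹)
    (h87 : ∀ x : Site d, InBox ((L : ℤ) • (y + e κ) - halfVec L) ((L : ℤ) • (y + e κ) + halfVec L) x →
      uLev L u j x = (wrecZ L U₀ (expCfg B₀) j x)⁻¹)
    (hU : ∀ x μ, avgIterZ L (mgauge U₀ u (expCfg B₀) * U₀) j x μ ∈ U1 𝔸) (hV₀ : ∀ x μ, avgIterZ L U₀ j x μ ∈ U1 𝔸)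
    (hW : avgIterZ L (mgauge U₀ u (expCfg B₀) * U₀) (j + 1) y κ ∈ U1 𝔸) (hW₀ : avgIterZ L U₀ (j + 1) y κ ∈ U1 𝔸)
    {α₁ : ℝ} (hα : 0 < α₁) (hsmall : (d : ℝ) * L * α₁ ≤ 1 / 8)
    (h135 : ∀ (z : Site d) (μ : Fin d), (L : ℤ) • (y + e κ) - halfVec L ≤ z → z + e μ ≤ (L : ℤ) • (y + e κ) + halfVec L →
      ‖(avgIterZ L (mgauge U₀ u (expCfg B₀) * U₀) j z μ : 𝔸) - (avgIterZ L U₀ j z μ : 𝔸)‖ ≤ α₁)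
    (h135b : ‖(avgIterZ L (mgauge U₀ u (expCfg B₀) * U₀) (j + 1) y κ : 𝔸) - (avgIterZ L U₀ (j + 1) y κ : 𝔸)‖ ≤ α₁) :
    ‖logCovIterZ L U₀ B₀ (j + 1) y κ‖ < 2 * d * L * α₁ := by
  rw [Qj_eq_BcrossMirror hLs U₀ B₀ u j hId y κ hm h87, norm_smul, Complex.norm_I, one_mul]
  have hw1 : avgIterZ L (mgauge U₀ u (expCfg B₀) * U₀) (j + 1) y κ * (avgIterZ L U₀ (j + 1) y κ)⁻¹ ∈ U1 𝔸 :=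
    (U1 𝔸).mul_mem hW ((U1 𝔸).inv_mem hW₀)
  have hw : ‖((avgIterZ L (mgauge U₀ u (expCfg B₀) * U₀) (j + 1) y κ * (avgIterZ L U₀ (j + 1) y κ)⁻¹ : 𝔸ˣ) : 𝔸) - 1‖
      ≤ α₁ :=
    (B8Thm2LogB.norm_mul_inv_sub_one_le _ hW₀).trans h135b
  have hs : B8Thm2LogB.BondSmall (pert (avgIterZ L (mgauge U₀ u (expCfg B₀) * U₀) j) (avgIterZ L U₀ j))
      ((L : ℤ) • (y + e κ) - halfVec L) ((L : ℤ) • (y + e κ) + halfVec L) α₁ := fun z μ hz hzμ =>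
    (B8Thm2LogB.norm_pert_sub_one_le _ _ z μ (hV₀ z μ)).trans (h135 z μ hz hzμ)
  have h := B8Thm2LogBRec.ineq137_crossing_mirrored L hLs hd hα hsmall (avgIterZ L U₀ j) _ hV₀
    (B8Thm2LogB.pert_mem hU hV₀) ((L : ℤ) • (y + e κ)) hs hW₀ hw1 hw
  rw [pert_avgIterZ_eq_tildIterZ] at h
  rwa [tildIterZ_apply L U₀ _ (j + 1) y κ]

/-! ## §5 Unconditional forms in the RECORD's Prop-4 regime (the identification `hId` discharged by `B7Eq123GeneralRec`) -/

omit [NormOneClass 𝔸] [NormedAlgebra ℂ 𝔸] [CompleteSpace 𝔸] in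
/-- In the record's regime `KZ(d,L)·Lᵏb ≤ c₃(d, L)` (`KZ = 2(1+2gZ) ≥ 2`) the exponent field is inside the ball of radius `ln 2` where `log ∘ exp = id`: `sup‖B₀‖ ≤ b < ln 2`
(the engine's `lt_log_two_of_regime` after `2·Lᵏb ≤ KZ·Lᵏb`). [cite: Balaban1985Averaging, Prop. 3 p.36 («c₃ depends on d and L»), (21) p.21; Balaban1987RG1, (0.4) p.253] -/
theorem lt_log_two_of_regimeZ {L : ℕ} (hL : 1 ≤ L) {k : ℕ} {b : ℝ} (hc₃ : KZ d L * ((L : ℝ) ^ k * b) ≤ c3 d L)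
    {B₀ : Site d → Fin d → 𝔸} (hB : ∀ x κ, ‖B₀ x κ‖ ≤ b) (z : Site d) (κ : Fin d) : ‖B₀ z κ‖ < Real.log 2 := by
  have hb0 : 0 ≤ b := (norm_nonneg _).trans (hB z κ)
  have hx : 0 ≤ (L : ℝ) ^ k * b := by positivity
  have hK2 : (2 : ℝ) ≤ KZ d L := by unfold KZ; have := gZ_nonneg d L; linarith
  exact lt_log_two_of_regime hL ((mul_le_mul_of_nonneg_right hK2 hx).trans hc₃) hB z κ

/-- (RECORD TWIN of `B8Eq137QjEqB.Qj_eq_Bint_regular`.) **(1.37) first half, interior bond, UNCONDITIONAL in the record's Prop-4 regime** (the hypotheses of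
`B7Eq123GeneralRec.dbavgCovIterZ_eq_expCfg_logCovIterZ` verbatim — odd `L = 2s+1`, `s ≥ 1`, `d ≥ 1`, `U₀` valued in a record-averaging-closed `G ≤ U1`, (1.40)
`pdev U₀ < α₀L^{−2k}`, `C0Z·α₀ ≤ 1∕3`, `4α₀ ≤ c₂′`, `sup‖B₀‖ ≤ b`, `e^{4cZ·α₀}(1 + 2C₁KZ²·Lᵏb) ≤ 2`, `KZ·Lᵏb ≤ c₃` — and `j ≤ k`): `Q_{j+1}(U₀, ηA)_b = i·B_b`.
[cite: Balaban1985RegularSpaces, (1.37) p.82, (1.40)–(1.41) p.83; Balaban1985Averaging, (127) p.37, Prop. 4 p.38; Balaban1987RG1, (0.4) p.253] -/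
theorem Qj_eq_Bint_regular {L s : ℕ} (hLs : L = 2 * s + 1) (hs : 1 ≤ s) (hd : 1 ≤ d) {G : Subgroup 𝔸ˣ} (hG : AvgClosedZ d L G) (k : ℕ)
    (U₀ : Site d → Fin d → 𝔸ˣ) (hU₀ : ∀ x κ, U₀ x κ ∈ G) {α₀ : ℝ} (hα₀ : 0 < α₀)
    (hα3 : C0Z d * α₀ ≤ 1 / 3) (hα4 : 4 * α₀ ≤ c2' d L) (h40 : pdev U₀ < α₀ * (((L : ℝ) ^ k)⁻¹) ^ 2)
    (B₀ : Site d → Fin d → 𝔸) {b : ℝ} (hb : 0 ≤ b) (hB : ∀ x κ, ‖B₀ x κ‖ ≤ b)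
    (hsm : Real.exp (4 * cZ d * α₀) * (1 + 2 * (131072 * ((d : ℝ) + 1) ^ 2) * (KZ d L) ^ 2 * ((L : ℝ) ^ k * b)) ≤ 2)
    (hc₃ : KZ d L * ((L : ℝ) ^ k * b) ≤ c3 d L) (u : Site d → 𝔸ˣ) {j : ℕ} (hjk : j ≤ k) (y : Site d) (κ : Fin d)
    (hm : uLev L u (j + 1) y = (wrecZ L U₀ (expCfg B₀) (j + 1) y)⁻¹)
    (hp : uLev L u (j + 1) (y + e κ) = (wrecZ L U₀ (expCfg B₀) (j + 1) (y + e κ))⁻¹) :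
    logCovIterZ L U₀ B₀ (j + 1) y κ = I • Bint (tildIterZ L U₀ (mgauge U₀ u (expCfg B₀)) (j + 1) y κ) :=
  Qj_eq_Bint L U₀ B₀ u j
    (dbavgCovIterZ_eq_expCfg_logCovIterZ L hLs hs hd hG k U₀ hU₀ hα₀ hα3 hα4 h40 B₀ hb hB hsm hc₃ j hjk) y κ hm hp

omit [NormOneClass 𝔸] in
/-- (RECORD TWIN of `B8Eq137QjEqB.Qj_eq_Bint_zero_regular`.) Level `0` in the same regime (`sup‖B₀‖ ≤ b < ln 2` by `lt_log_two_of_regimeZ`): `Q₀(U₀, ηA)_b = i·B_b`.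
[cite: Balaban1985RegularSpaces, (1.37) p.82, (1.14) p.78; Balaban1985Averaging, (127) p.37; Balaban1987RG1, (0.4) p.253] -/
theorem Qj_eq_Bint_zero_regular (L : ℕ) (hL : 1 ≤ L) (k : ℕ) (U₀ : Site d → Fin d → 𝔸ˣ)
    (B₀ : Site d → Fin d → 𝔸) {b : ℝ} (hB : ∀ x κ, ‖B₀ x κ‖ ≤ b) (hc₃ : KZ d L * ((L : ℝ) ^ k * b) ≤ c3 d L)
    (u : Site d → 𝔸ˣ) (y : Site d) (κ : Fin d) (hm : uLev L u 0 y = (wrecZ L U₀ (expCfg B₀) 0 y)⁻¹)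
    (hp : uLev L u 0 (y + e κ) = (wrecZ L U₀ (expCfg B₀) 0 (y + e κ))⁻¹) :
    logCovIterZ L U₀ B₀ 0 y κ = I • Bint (tildIterZ L U₀ (mgauge U₀ u (expCfg B₀)) 0 y κ) :=
  Qj_eq_Bint_zero L U₀ B₀ u y κ (lt_log_two_of_regimeZ hL hc₃ hB y κ) hm hp

/-- (RECORD TWIN of `B8Eq137QjEqB.Qj_eq_Bcross_regular`.) **(1.37) first half, crossing bond, UNCONDITIONAL in the record's Prop-4 regime.**
[cite: Balaban1985RegularSpaces, (1.37) p.82, (1.31) p.82; Balaban1985Averaging, (127) p.37, Prop. 4 p.38; Balaban1987RG1, (0.3)–(0.4) pp.252–253] -/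
theorem Qj_eq_Bcross_regular {L s : ℕ} (hLs : L = 2 * s + 1) (hs : 1 ≤ s) (hd : 1 ≤ d) {G : Subgroup 𝔸ˣ} (hG : AvgClosedZ d L G) (k : ℕ)
    (U₀ : Site d → Fin d → 𝔸ˣ) (hU₀ : ∀ x κ, U₀ x κ ∈ G) {α₀ : ℝ} (hα₀ : 0 < α₀)
    (hα3 : C0Z d * α₀ ≤ 1 / 3) (hα4 : 4 * α₀ ≤ c2' d L) (h40 : pdev U₀ < α₀ * (((L : ℝ) ^ k)⁻¹) ^ 2)
    (B₀ : Site d → Fin d → 𝔸) {b : ℝ} (hb : 0 ≤ b) (hB : ∀ x κ, ‖B₀ x κ‖ ≤ b)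
    (hsm : Real.exp (4 * cZ d * α₀) * (1 + 2 * (131072 * ((d : ℝ) + 1) ^ 2) * (KZ d L) ^ 2 * ((L : ℝ) ^ k * b)) ≤ 2)
    (hc₃ : KZ d L * ((L : ℝ) ^ k * b) ≤ c3 d L) (u : Site d → 𝔸ˣ) {j : ℕ} (hjk : j ≤ k) (y : Site d) (κ : Fin d)
    (h87 : ∀ x : Site d, InBox ((L : ℤ) • y - halfVec L) ((L : ℤ) • y + halfVec L) x →
      uLev L u j x = (wrecZ L U₀ (expCfg B₀) j x)⁻¹)
    (hp : uLev L u (j + 1) (y + e κ) = (wrecZ L U₀ (expCfg B₀) (j + 1) (y + e κ))⁻¹) :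
    logCovIterZ L U₀ B₀ (j + 1) y κ
      = I • BcrossZ L (avgIterZ L U₀ j) (tildIterZ L U₀ (mgauge U₀ u (expCfg B₀)) j) ((L : ℤ) • y)
          (tildIterZ L U₀ (mgauge U₀ u (expCfg B₀)) (j + 1) y κ) :=
  Qj_eq_Bcross hLs U₀ B₀ u j
    (dbavgCovIterZ_eq_expCfg_logCovIterZ L hLs hs hd hG k U₀ hU₀ hα₀ hα3 hα4 h40 B₀ hb hB hsm hc₃ j hjk) y κ h87 hp

/-- (RECORD TWIN of `B8Eq137QjEqB.Qj_eq_BcrossMirror_regular`.) **(1.37) first half, mirrored crossing bond, UNCONDITIONAL in the record's Prop-4 regime.**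
[cite: Balaban1985RegularSpaces, (1.37) p.82, (1.31) p.82; Balaban1985Averaging, (127) p.37, Prop. 4 p.38; Balaban1987RG1, (0.3)–(0.4) pp.252–253] -/
theorem Qj_eq_BcrossMirror_regular {L s : ℕ} (hLs : L = 2 * s + 1) (hs : 1 ≤ s) (hd : 1 ≤ d) {G : Subgroup 𝔸ˣ} (hG : AvgClosedZ d L G)
    (k : ℕ) (U₀ : Site d → Fin d → 𝔸ˣ) (hU₀ : ∀ x κ, U₀ x κ ∈ G) {α₀ : ℝ} (hα₀ : 0 < α₀)
    (hα3 : C0Z d * α₀ ≤ 1 / 3) (hα4 : 4 * α₀ ≤ c2' d L) (h40 : pdev U₀ < α₀ * (((L : ℝ) ^ k)⁻¹) ^ 2)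
    (B₀ : Site d → Fin d → 𝔸) {b : ℝ} (hb : 0 ≤ b) (hB : ∀ x κ, ‖B₀ x κ‖ ≤ b)
    (hsm : Real.exp (4 * cZ d * α₀) * (1 + 2 * (131072 * ((d : ℝ) + 1) ^ 2) * (KZ d L) ^ 2 * ((L : ℝ) ^ k * b)) ≤ 2)
    (hc₃ : KZ d L * ((L : ℝ) ^ k * b) ≤ c3 d L) (u : Site d → 𝔸ˣ) {j : ℕ} (hjk : j ≤ k) (y : Site d) (κ : Fin d)
    (hm : uLev L u (j + 1) y = (wrecZ L U₀ (expCfg B₀) (j + 1) y)⁻¹)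
    (h87 : ∀ x : Site d, InBox ((L : ℤ) • (y + e κ) - halfVec L) ((L : ℤ) • (y + e κ) + halfVec L) x →
      uLev L u j x = (wrecZ L U₀ (expCfg B₀) j x)⁻¹) :
    logCovIterZ L U₀ B₀ (j + 1) y κ
      = I • BcrossMirrorZ L (avgIterZ L U₀ j) (tildIterZ L U₀ (mgauge U₀ u (expCfg B₀)) j) ((L : ℤ) • (y + e κ))
          (avgIterZ L U₀ (j + 1) y κ) (tildIterZ L U₀ (mgauge U₀ u (expCfg B₀)) (j + 1) y κ) :=
  Qj_eq_BcrossMirror hLs U₀ B₀ u j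
    (dbavgCovIterZ_eq_expCfg_logCovIterZ L hLs hs hd hG k U₀ hU₀ hα₀ hα3 hα4 h40 B₀ hb hB hsm hc₃ j hjk) y κ hm h87

/-- (RECORD TWIN of `B8Eq137QjEqB.norm_Qj_lt_interior_regular`.) **(1.42) clause «|Q_j(U₀, ηA)| < 2dLα₁» from (1.35), interior bond, UNCONDITIONAL in the record's
Prop-4 regime** (`j + 1 ≤ k`; the `U1`-membership of `Ū₀^{j+1}_b` from `U₀ ∈ G`, `G` record-averaging-closed: `B7Eq123GeneralRec.level_dataZ`).
[cite: Balaban1985RegularSpaces, (1.42) p.83, (1.37) p.82, (1.35) p.82; Balaban1987RG1, (0.4) p.253] -/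
theorem norm_Qj_lt_interior_regular {L s : ℕ} (hLs : L = 2 * s + 1) (hs : 1 ≤ s) (hd : 1 ≤ d) {G : Subgroup 𝔸ˣ} (hG : AvgClosedZ d L G)
    (k : ℕ) (U₀ : Site d → Fin d → 𝔸ˣ) (hU₀ : ∀ x κ, U₀ x κ ∈ G) {α₀ : ℝ} (hα₀ : 0 < α₀)
    (hα3 : C0Z d * α₀ ≤ 1 / 3) (hα4 : 4 * α₀ ≤ c2' d L) (h40 : pdev U₀ < α₀ * (((L : ℝ) ^ k)⁻¹) ^ 2)
    (B₀ : Site d → Fin d → 𝔸) {b : ℝ} (hb : 0 ≤ b) (hB : ∀ x κ, ‖B₀ x κ‖ ≤ b)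
    (hsm : Real.exp (4 * cZ d * α₀) * (1 + 2 * (131072 * ((d : ℝ) + 1) ^ 2) * (KZ d L) ^ 2 * ((L : ℝ) ^ k * b)) ≤ 2)
    (hc₃ : KZ d L * ((L : ℝ) ^ k * b) ≤ c3 d L) (u : Site d → 𝔸ˣ) {j : ℕ} (hjk : j + 1 ≤ k) (y : Site d) (κ : Fin d)
    (hm : uLev L u (j + 1) y = (wrecZ L U₀ (expCfg B₀) (j + 1) y)⁻¹)
    (hp : uLev L u (j + 1) (y + e κ) = (wrecZ L U₀ (expCfg B₀) (j + 1) (y + e κ))⁻¹)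
    {α₁ : ℝ} (hα : 0 < α₁) (hsmall : (d : ℝ) * L * α₁ ≤ 1 / 8)
    (h135 : ‖(avgIterZ L (mgauge U₀ u (expCfg B₀) * U₀) (j + 1) y κ : 𝔸) - (avgIterZ L U₀ (j + 1) y κ : 𝔸)‖ ≤ α₁) :
    ‖logCovIterZ L U₀ B₀ (j + 1) y κ‖ < 2 * d * L * α₁ :=
  have hL2 : 2 ≤ L := by omega
  norm_Qj_lt_interior L hd (by omega) U₀ B₀ u j
    (dbavgCovIterZ_eq_expCfg_logCovIterZ L hLs hs hd hG k U₀ hU₀ hα₀ hα3 hα4 h40 B₀ hb hB hsm hc₃ j (Nat.le_of_succ_le hjk))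
    y κ hm hp ((level_dataZ L hL2 hG k U₀ hU₀ hα₀ hα3 hα4 h40 (j + 1) hjk).1 y κ) hα hsmall h135

/-- (RECORD TWIN of `B8Eq137QjEqB.norm_Qj_lt_crossing_regular`.) **(1.42) clause from (1.35), crossing bond, UNCONDITIONAL in the record's Prop-4 regime** (the
`U1`-memberships of the record averages of `U₀` from `U₀ ∈ G`; those of `(U′U₀)‾` kept as hypotheses — print's `U′U₀ ∈ 𝔄_k` side, [3] Prop. 2 for the record).
[cite: Balaban1985RegularSpaces, (1.42) p.83, (1.37) p.82, (1.35) p.82; Balaban1987RG1, (0.3)–(0.4) pp.252–253] -/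
theorem norm_Qj_lt_crossing_regular {L s : ℕ} (hLs : L = 2 * s + 1) (hs : 1 ≤ s) (hd : 1 ≤ d) {G : Subgroup 𝔸ˣ} (hG : AvgClosedZ d L G)
    (k : ℕ) (U₀ : Site d → Fin d → 𝔸ˣ) (hU₀ : ∀ x κ, U₀ x κ ∈ G) {α₀ : ℝ} (hα₀ : 0 < α₀)
    (hα3 : C0Z d * α₀ ≤ 1 / 3) (hα4 : 4 * α₀ ≤ c2' d L) (h40 : pdev U₀ < α₀ * (((L : ℝ) ^ k)⁻¹) ^ 2)
    (B₀ : Site d → Fin d → 𝔸) {b : ℝ} (hb : 0 ≤ b) (hB : ∀ x κ, ‖B₀ x κ‖ ≤ b)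
    (hsm : Real.exp (4 * cZ d * α₀) * (1 + 2 * (131072 * ((d : ℝ) + 1) ^ 2) * (KZ d L) ^ 2 * ((L : ℝ) ^ k * b)) ≤ 2)
    (hc₃ : KZ d L * ((L : ℝ) ^ k * b) ≤ c3 d L) (u : Site d → 𝔸ˣ) {j : ℕ} (hjk : j + 1 ≤ k) (y : Site d) (κ : Fin d)
    (h87 : ∀ x : Site d, InBox ((L : ℤ) • y - halfVec L) ((L : ℤ) • y + halfVec L) x →
      uLev L u j x = (wrecZ L U₀ (expCfg B₀) j x)⁻¹)
    (hp : uLev L u (j + 1) (y + e κ) = (wrecZ L U₀ (expCfg B₀) (j + 1) (y + e κ))⁻¹)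
    (hU : ∀ x μ, avgIterZ L (mgauge U₀ u (expCfg B₀) * U₀) j x μ ∈ U1 𝔸)
    (hW : avgIterZ L (mgauge U₀ u (expCfg B₀) * U₀) (j + 1) y κ ∈ U1 𝔸)
    {α₁ : ℝ} (hα : 0 < α₁) (hsmall : (d : ℝ) * L * α₁ ≤ 1 / 8)
    (h135 : ∀ (z : Site d) (μ : Fin d), (L : ℤ) • y - halfVec L ≤ z → z + e μ ≤ (L : ℤ) • y + halfVec L →
      ‖(avgIterZ L (mgauge U₀ u (expCfg B₀) * U₀) j z μ : 𝔸) - (avgIterZ L U₀ j z μ : 𝔸)‖ ≤ α₁)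
    (h135b : ‖(avgIterZ L (mgauge U₀ u (expCfg B₀) * U₀) (j + 1) y κ : 𝔸) - (avgIterZ L U₀ (j + 1) y κ : 𝔸)‖ ≤ α₁) :
    ‖logCovIterZ L U₀ B₀ (j + 1) y κ‖ < 2 * d * L * α₁ :=
  have hL2 : 2 ≤ L := by omega
  norm_Qj_lt_crossing hLs hd U₀ B₀ u j
    (dbavgCovIterZ_eq_expCfg_logCovIterZ L hLs hs hd hG k U₀ hU₀ hα₀ hα3 hα4 h40 B₀ hb hB hsm hc₃ j (Nat.le_of_succ_le hjk))
    y κ h87 hp hU (level_dataZ L hL2 hG k U₀ hU₀ hα₀ hα3 hα4 h40 j (Nat.le_of_succ_le hjk)).1 hW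
    ((level_dataZ L hL2 hG k U₀ hU₀ hα₀ hα3 hα4 h40 (j + 1) hjk).1 y κ) hα hsmall h135 h135b

end Literature.MathematicalPhysics.QuantumFieldTheory.Balaban1983to89.B8Eq137QjEqBRec

end
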